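import Summits.QuantumFields.YangMills.Theorems.EquipartitionCriticalityEquipartitionPinsProbeTangentSteinPrelim
import HarnessLib

/-!
# Finite-`β` Stein identity, part 2: the abstract core estimate (crux `stmt-QuantumFields-8760`, line `Sketch`, STUB TS7)

The analytic heart of STUB TS7 `stub_steinFiniteBeta`, in abstract form (`core_defect`): on a compact
state space with a probability measure `μ` and a jointly continuous flow `T_t`, if the coordinates `Y_p^a`
have flow-derivative `√β(σ δ_{ab} dδ_p + err)` with `err² ≤ K W_p`, the "action" `Se` has flow-derivative
`D` with `|√β D − σ ∑_q dδ_q Y_q^b| ≤ K√β ∑_q W_q`, and the skew shift identity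
`∫ Fn(L ∘ T_t) dμ = ∫ Fn(L) e^{−β(Se∘T_{−t} − Se)} dμ` holds for a bounded test function `Fn` with bounded
derivative, then the trigonometric Stein defect `|κ ∫ Fn'(L) − ∫ Fn(L) ℓ|` is at most
`∫ ∑ |h|(θ/2 + K W/(2θ)) + K√β ∫ ∑ W` for every `θ > 0`. Proof: differentiate the identity at `t = 0` under
the integral sign (STUB TS5 `stub_diffIdentity`; Lipschitz constants from the flow property and
compactness, measurability of the derivatives from `measurable_deriv_with_param`) and bound the two
remainders pointwise (AM–GM). Reference: S. Chatterjee, arXiv:1602.01222 §11 (Stein/Schwinger–Dyson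
heuristics for lattice gauge theory). [arXiv160201222]
-/

noncomputable section

open MeasureTheory Filter Topology
open scoped Matrix Matrix.Norms.Frobenius
open Literature.Probability.LatticeModels Literature.MathematicalPhysics.QuantumLattice
open Literature.MathematicalPhysics.QuantumFieldTheory hiding ZdEdge IsLocalObservable IsInfiniteVolumeLimit

namespace Summit.QuantumFields.YangMills.Theorems.EquipartitionPinsProbe

namespace TangentSteinFiniteBeta

/-! ### The core estimate (abstract) -/

section Core

variable {X : Type} [TopologicalSpace X] [CompactSpace X] [MeasurableSpace X] [OpensMeasurableSpace X]

/-- **Core estimate (abstract form).** On a compact state space `X` with a probability measure `μ`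
and a jointly continuous flow `T_t`, let `Y_p^a`, `W_p`, `Se` be continuous functions of the state,
`L = ∑_{p∈S}∑_a h_p^a Y_p^a`, `ℓ = ∑_{p∈S} dδ_p Y_p^b`, with `dδ = 0` on `S ∖ Pe`, `Pe ⊆ S`. Assume: the
derivative of `Y_p^a` along the flow at `0` is `√β(σ δ_{ab} dδ_p + err)` with `err² ≤ K W_p`; the
derivative `D` of `Se` along the flow satisfies `|√β D − σ ∑_{q∈Pe} dδ_q Y_q^b| ≤ K√β ∑_{q∈Pe} W_q`;
and the skew shift identity `∫ Fn(L ∘ T_t) dμ = ∫ Fn(L) e^{−β(Se∘T_{−t} − Se)} dμ` holds for all `t`,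
for a test function `Fn` with derivative `Fn'`, both bounded by `1`, `Fn` `1`-Lipschitz. Then for
every `θ > 0`, `|κ ∫ Fn'(L) − ∫ Fn(L) ℓ| ≤ ∫ ∑_{p,a} |h_p^a| (θ/2 + K W_p/(2θ)) + K√β ∫ ∑_{q∈Pe} W_q`
(`κ = ∑_{p∈S} dδ_p h_p^b`): differentiate the shift identity at `t = 0` under the integral sign
(`stub_diffIdentity`; Lipschitz bounds from the flow property and compactness) and estimate the two
error terms pointwise. -/
theorem core_defect (μ : Measure X) [IsProbabilityMeasure μ] {β : ℝ} (hβ : 0 < β)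
    {ι : Type} (S Pe : Finset ι) (hPS : Pe ⊆ S) {Dc : ℕ} (b : Fin Dc) (h : ι → Fin Dc → ℝ)
    (dδ : ι → ℝ) (hδ0 : ∀ p ∈ S, p ∉ Pe → dδ p = 0) {Cδ : ℝ} (hCδ0 : 0 ≤ Cδ) (hCδ : ∀ p, |dδ p| ≤ Cδ)
    (σ : ℝ) (hσ : σ = 1 ∨ σ = -1)
    (T : ℝ → X → X) (hT0 : ∀ U, T 0 U = U) (hflow : ∀ s t U, T (t + s) U = T t (T s U))
    (hTc : Continuous fun q : ℝ × X => T q.1 q.2)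
    (Y : X → ι → Fin Dc → ℝ) (hYc : ∀ p a, Continuous fun U => Y U p a)
    (W : X → ι → ℝ) (hWc : ∀ p, Continuous fun U => W U p)
    (Se : X → ℝ) (hSec : Continuous Se)
    (L : X → ℝ) (hL : ∀ U, L U = ∑ p ∈ S, ∑ a, h p a * Y U p a)
    (ℓ : X → ℝ) (hℓ : ∀ U, ℓ U = ∑ p ∈ S, dδ p * Y U p b)
    (K : ℝ) (hK : 0 ≤ K)
    (hY : ∀ (U : X) (p : ι) (a : Fin Dc), ∃ err : ℝ,
      HasDerivAt (fun t => Y (T t U) p a) (Real.sqrt β * (σ * (if a = b then dδ p else 0) + err)) 0 ∧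
      err ^ 2 ≤ K * W U p)
    (hD : ∀ U : X, ∃ D : ℝ, HasDerivAt (fun t => Se (T t U)) D 0 ∧
      |Real.sqrt β * D - σ * ∑ q ∈ Pe, dδ q * Y U q b| ≤ K * Real.sqrt β * ∑ q ∈ Pe, W U q)
    (Fn Fn' : ℝ → ℝ) (hFn : ∀ x, HasDerivAt Fn (Fn' x) x) (hFn'c : Continuous Fn')
    (hFb : ∀ x, |Fn x| ≤ 1) (hFb' : ∀ x, |Fn' x| ≤ 1) (hFlip : ∀ x y, |Fn x - Fn y| ≤ |x - y|)
    (hHaar : ∀ t : ℝ, ∫ U, Fn (L (T t U)) ∂μ = ∫ U, Fn (L U) * Real.exp (-(β * (Se (T (-t) U) - Se U))) ∂μ)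
    {θ : ℝ} (hθ : 0 < θ) :
    |(∑ p ∈ S, dδ p * h p b) * (∫ U, Fn' (L U) ∂μ) - ∫ U, Fn (L U) * ℓ U ∂μ| ≤
      (∫ U, ∑ p ∈ S, ∑ a, |h p a| * (θ / 2 + K * W U p / (2 * θ)) ∂μ) +
        K * Real.sqrt β * ∫ U, ∑ q ∈ Pe, W U q ∂μ := by
  classical
  have hsβ : 0 < Real.sqrt β := Real.sqrt_pos.2 hβ
  have hσabs : |σ| = 1 := by rcases hσ with rfl | rfl <;> simp
  have hσsq : σ * σ = 1 := by rcases hσ with rfl | rfl <;> norm_num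
  -- continuity of the players
  have hLc : Continuous L := by
    have : L = fun U => ∑ p ∈ S, ∑ a, h p a * Y U p a := funext hL
    rw [this]
    exact continuous_finsetSum _ fun p _ => continuous_finsetSum _ fun a _ => continuous_const.mul (hYc p a)
  have hℓc : Continuous ℓ := by
    have : ℓ = fun U => ∑ p ∈ S, dδ p * Y U p b := funext hℓ
    rw [this]
    exact continuous_finsetSum _ fun p _ => continuous_const.mul (hYc p b)
  obtain ⟨CS, -, hCS⟩ := exists_abs_le_of_continuous hSec
  have hFnc : Continuous Fn := continuous_iff_continuousAt.2 fun x => (hFn x).continuousAt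
  have hTt : ∀ t, Continuous fun U => T t U := continuous_slice T hTc
  -- uniform bounds (compactness)
  choose CW hCW0 hCW using fun p => exists_abs_le_of_continuous (hWc p)
  choose CY hCY0 hCY using fun p => exists_abs_le_of_continuous (hYc p b)
  -- the derivative data
  choose err herr using hY
  choose D hDer using hD
  -- bound on the field derivative
  have herrb : ∀ U p a, |err U p a| ≤ Real.sqrt (K * CW p) := fun U p a => by
    refine Real.abs_le_sqrt ((herr U p a).2.trans ?_)
    exact mul_le_mul_of_nonneg_left ((le_abs_self _).trans (hCW p U)) hK
  have hYd : ∀ U p a, |Real.sqrt β * (σ * (if a = b then dδ p else 0) + err U p a)| ≤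
      Real.sqrt β * (Cδ + Real.sqrt (K * CW p)) := fun U p a => by
    rw [abs_mul, abs_of_pos hsβ]
    refine mul_le_mul_of_nonneg_left ((abs_add_le _ _).trans (add_le_add ?_ (herrb U p a))) hsβ.le
    rw [abs_mul, hσabs, one_mul]
    split_ifs
    · exact hCδ p
    · simpa using hCδ0
  -- Lipschitz bound for the field along the flow
  have hYlip : ∀ p a U t s, |Y (T t U) p a - Y (T s U) p a| ≤ Real.sqrt β * (Cδ + Real.sqrt (K * CW p)) * |t - s| :=
    fun p a => lipschitz_of_flow T hflow (fun U => Y U p a) _ (fun U => (herr U p a).1) (fun U => hYd U p a)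
  obtain ⟨LL, hLL0, hLlip, hLLb⟩ : ∃ LL : ℝ, 0 ≤ LL ∧ (∀ U t s, |L (T t U) - L (T s U)| ≤ LL * |t - s|) ∧
      ∀ U, |∑ p ∈ S, ∑ a, h p a * (Real.sqrt β * (σ * (if a = b then dδ p else 0) + err U p a))| ≤ LL := by
    refine ⟨∑ p ∈ S, ∑ a : Fin Dc, |h p a| * (Real.sqrt β * (Cδ + Real.sqrt (K * CW p))),
      Finset.sum_nonneg fun p _ => Finset.sum_nonneg fun a _ => by positivity, fun U t s => ?_, fun U => ?_⟩
    swap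
    · refine (Finset.abs_sum_le_sum_abs _ _).trans (Finset.sum_le_sum fun p _ => ?_)
      refine (Finset.abs_sum_le_sum_abs _ _).trans (Finset.sum_le_sum fun a _ => ?_)
      rw [abs_mul]
      exact mul_le_mul_of_nonneg_left (hYd U p a) (abs_nonneg _)
    rw [hL, hL, ← Finset.sum_sub_distrib, Finset.sum_mul]
    refine (Finset.abs_sum_le_sum_abs _ _).trans (Finset.sum_le_sum fun p _ => ?_)
    rw [← Finset.sum_sub_distrib, Finset.sum_mul]
    refine (Finset.abs_sum_le_sum_abs _ _).trans (Finset.sum_le_sum fun a _ => ?_)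
    rw [← mul_sub, abs_mul, mul_assoc]
    exact mul_le_mul_of_nonneg_left (hYlip p a U t s) (abs_nonneg _)
  -- bound on the action derivative and Lipschitz bound for the action along the flow
  obtain ⟨LD, hLD0, hDb⟩ : ∃ LD : ℝ, 0 ≤ LD ∧ ∀ U, |D U| ≤ LD := by
    refine ⟨((∑ q ∈ Pe, Cδ * CY q) + K * Real.sqrt β * ∑ q ∈ Pe, CW q) / Real.sqrt β, ?_, fun U => ?_⟩
    · refine div_nonneg (add_nonneg (Finset.sum_nonneg fun q _ => mul_nonneg hCδ0 (hCY0 q)) ?_) hsβ.le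
      exact mul_nonneg (mul_nonneg hK hsβ.le) (Finset.sum_nonneg fun q _ => hCW0 q)
    · have h1 := (hDer U).2
      have h2 : |σ * ∑ q ∈ Pe, dδ q * Y U q b| ≤ ∑ q ∈ Pe, Cδ * CY q := by
        rw [abs_mul, hσabs, one_mul]
        refine (Finset.abs_sum_le_sum_abs _ _).trans (Finset.sum_le_sum fun q _ => ?_)
        rw [abs_mul]
        exact mul_le_mul (hCδ q) (hCY q U) (abs_nonneg _) hCδ0
      have h3 : K * Real.sqrt β * ∑ q ∈ Pe, W U q ≤ K * Real.sqrt β * ∑ q ∈ Pe, CW q :=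
        mul_le_mul_of_nonneg_left (Finset.sum_le_sum fun q _ => (le_abs_self _).trans (hCW q U)) (mul_nonneg hK hsβ.le)
      have h4 : |Real.sqrt β * D U| ≤ (∑ q ∈ Pe, Cδ * CY q) + K * Real.sqrt β * ∑ q ∈ Pe, CW q := by
        have := abs_sub_abs_le_abs_sub (Real.sqrt β * D U) (σ * ∑ q ∈ Pe, dδ q * Y U q b)
        linarith
      rw [le_div_iff₀ hsβ, mul_comm]
      rwa [abs_mul, abs_of_pos hsβ] at h4
  have hSlip : ∀ U t s, |Se (T t U) - Se (T s U)| ≤ LD * |t - s| :=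
    lipschitz_of_flow T hflow Se D (fun U => (hDer U).1) hDb
  -- the exponent `g_U(t) = -β (Se(T_{-t} U) - Se U)`: bounded above and Lipschitz
  have hgM : ∀ U t, -(β * (Se (T (-t) U) - Se U)) ≤ 2 * β * CS := fun U t => by
    have h1 := hCS (T (-t) U); have h2 := hCS U
    rw [abs_le] at h1 h2
    nlinarith
  have hglip : ∀ U t s, |-(β * (Se (T (-t) U) - Se U)) - -(β * (Se (T (-s) U) - Se U))| ≤ β * LD * |t - s| :=
    fun U t s => by
    have := hSlip U (-t) (-s)
    rw [show -(β * (Se (T (-t) U) - Se U)) - -(β * (Se (T (-s) U) - Se U)) =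
      -(β * (Se (T (-t) U) - Se (T (-s) U))) by ring, abs_neg, abs_mul, abs_of_pos hβ, mul_assoc]
    refine mul_le_mul_of_nonneg_left (this.trans_eq ?_) hβ.le
    rw [show -t - -s = -(t - s) by ring, abs_neg]
  -- the constant for `stub_diffIdentity`
  obtain ⟨K5, hK5a, hK5b, hK5c, hK5d⟩ : ∃ K5 : ℝ, 1 ≤ K5 ∧ Real.exp (2 * β * CS) ≤ K5 ∧ LL ≤ K5 ∧
      Real.exp (2 * β * CS) * (β * LD) ≤ K5 := by
    have hexp0 : 0 ≤ Real.exp (2 * β * CS) := (Real.exp_pos _).le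
    have hprod0 : 0 ≤ Real.exp (2 * β * CS) * (β * LD) := mul_nonneg hexp0 (mul_nonneg hβ.le hLD0)
    exact ⟨1 + Real.exp (2 * β * CS) + LL + Real.exp (2 * β * CS) * (β * LD), by linarith, by linarith,
      by linarith, by linarith⟩
  have hexp0 : 0 ≤ Real.exp (2 * β * CS) := (Real.exp_pos _).le
  -- the two families `A t U = Fn(L(T_t U))`, `B t U = Fn(L U) exp(g_U(t))`
  have hAbd : ∀ (t : ℝ) (U : X), |Fn (L (T t U))| ≤ K5 := fun t U => (hFb _).trans hK5a
  have hBbd : ∀ (t : ℝ) (U : X), |Fn (L U) * Real.exp (-(β * (Se (T (-t) U) - Se U)))| ≤ K5 := fun t U => by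
    rw [abs_mul, Real.abs_exp]
    have : |Fn (L U)| * Real.exp (-(β * (Se (T (-t) U) - Se U))) ≤ 1 * Real.exp (2 * β * CS) :=
      mul_le_mul (hFb _) (Real.exp_le_exp.2 (hgM U t)) (Real.exp_pos _).le zero_le_one
    linarith
  have hAlip : ∀ (U : X) (t s : ℝ), |Fn (L (T t U)) - Fn (L (T s U))| ≤ K5 * |t - s| := fun U t s =>
    ((hFlip _ _).trans (hLlip U t s)).trans (mul_le_mul_of_nonneg_right hK5c (abs_nonneg _))
  have hBlip : ∀ (U : X) (t s : ℝ), |Fn (L U) * Real.exp (-(β * (Se (T (-t) U) - Se U))) -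
      Fn (L U) * Real.exp (-(β * (Se (T (-s) U) - Se U)))| ≤ K5 * |t - s| := fun U t s => by
    rw [← mul_sub, abs_mul]
    have h1 : |Real.exp (-(β * (Se (T (-t) U) - Se U))) - Real.exp (-(β * (Se (T (-s) U) - Se U)))| ≤
        Real.exp (2 * β * CS) * (β * LD * |t - s|) :=
      (abs_exp_sub_exp_le (hgM U t) (hgM U s)).trans (mul_le_mul_of_nonneg_left (hglip U t s) hexp0)
    have h2 := mul_le_mul (hFb (L U)) h1 (abs_nonneg _) zero_le_one
    refine h2.trans ?_
    rw [one_mul, ← mul_assoc]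
    exact mul_le_mul_of_nonneg_right hK5d (abs_nonneg _)
  -- measurability
  have hAm : ∀ t : ℝ, Measurable fun U => Fn (L (T t U)) := fun t => (hFnc.comp (hLc.comp (hTt t))).measurable
  have hgc : Continuous fun q : ℝ × X => -(β * (Se (T (-q.1) q.2) - Se q.2)) := by
    have h1 : Continuous fun q : ℝ × X => Se (T (-q.1) q.2) :=
      hSec.comp (hTc.comp ((continuous_neg.comp continuous_fst).prodMk continuous_snd))
    exact (continuous_const.mul (h1.sub (hSec.comp continuous_snd))).neg
  have hBm : ∀ t : ℝ, Measurable fun U => Fn (L U) * Real.exp (-(β * (Se (T (-t) U) - Se U))) := fun t =>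
    ((hFnc.comp hLc).mul (Real.continuous_exp.comp (hgc.comp (continuous_const.prodMk continuous_id)))).measurable
  have ham : Measurable fun U => deriv (fun t => Fn (L (T t U))) 0 :=
    measurable_deriv_param (fun t U => Fn (L (T t U))) (hFnc.comp (hLc.comp hTc))
  have hbm : Measurable fun U => deriv (fun t => Fn (L U) * Real.exp (-(β * (Se (T (-t) U) - Se U)))) 0 :=
    measurable_deriv_param (fun t U => Fn (L U) * Real.exp (-(β * (Se (T (-t) U) - Se U))))
      (((hFnc.comp hLc).comp continuous_snd).mul (Real.continuous_exp.comp hgc))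
  -- derivatives at 0
  have hA0 : ∀ U, HasDerivAt (fun t => Fn (L (T t U)))
      (Fn' (L U) * ∑ p ∈ S, ∑ a, h p a * (Real.sqrt β * (σ * (if a = b then dδ p else 0) + err U p a))) 0 := by
    intro U
    have hin : HasDerivAt (fun t => L (T t U))
        (∑ p ∈ S, ∑ a, h p a * (Real.sqrt β * (σ * (if a = b then dδ p else 0) + err U p a))) 0 := by
      have : (fun t => L (T t U)) = fun t => ∑ p ∈ S, ∑ a, h p a * Y (T t U) p a := funext fun t => hL _
      rw [this]
      exact HasDerivAt.fun_sum fun p _ => HasDerivAt.fun_sum fun a _ => (herr U p a).1.const_mul (h p a)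
    have := (hFn (L (T 0 U))).comp 0 hin
    rw [hT0] at this
    exact this
  have hB0 : ∀ U, HasDerivAt (fun t => Fn (L U) * Real.exp (-(β * (Se (T (-t) U) - Se U)))) (Fn (L U) * (β * D U)) 0 := by
    intro U
    have h1 : HasDerivAt (fun t => Se (T t U)) (D U) (-0) := by
      rw [neg_zero]
      have := hasDerivAt_of_flow T hflow Se D (fun U => (hDer U).1) 0 U
      rwa [hT0] at this
    have h2 : HasDerivAt (fun t => Se (T (-t) U)) (-(D U)) 0 := by
      have := h1.scomp 0 (hasDerivAt_neg 0)
      rw [smul_eq_mul, neg_one_mul] at this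
      exact this
    have h3 : HasDerivAt (fun t => -(β * (Se (T (-t) U) - Se U))) (β * D U) 0 :=
      ((h2.sub_const (Se U)).const_mul β).neg.congr_deriv (by ring)
    have h4 := (h3.exp).const_mul (Fn (L U))
    have hg0 : -(β * (Se (T (-0) U) - Se U)) = 0 := by rw [neg_zero, hT0, sub_self, mul_zero, neg_zero]
    rw [hg0, Real.exp_zero, one_mul] at h4
    exact h4
  -- differentiate under the integral sign (STUB TS5)
  have hdiff := stub_diffIdentity X μ inferInstance (fun t U => Fn (L (T t U)))
    (fun t U => Fn (L U) * Real.exp (-(β * (Se (T (-t) U) - Se U))))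
    (fun U => deriv (fun t => Fn (L (T t U))) 0)
    (fun U => deriv (fun t => Fn (L U) * Real.exp (-(β * (Se (T (-t) U) - Se U)))) 0) K5 hAm hBm ham hbm hAbd hBbd
    hAlip hBlip (fun U => (hA0 U).differentiableAt.hasDerivAt) (fun U => (hB0 U).differentiableAt.hasDerivAt) hHaar
  have ha' : (fun U => deriv (fun t => Fn (L (T t U))) 0) =
      fun U => Fn' (L U) * ∑ p ∈ S, ∑ a, h p a * (Real.sqrt β * (σ * (if a = b then dδ p else 0) + err U p a)) :=
    funext fun U => (hA0 U).deriv
  have hb' : (fun U => deriv (fun t => Fn (L U) * Real.exp (-(β * (Se (T (-t) U) - Se U)))) 0) =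
      fun U => Fn (L U) * (β * D U) := funext fun U => (hB0 U).deriv
  rw [ha', hb'] at hdiff
  -- hdiff : ∫ Fn'(L U) * ∑∑ h (√β (σδ + err)) = ∫ Fn(L U) * (β * D U)
  -- pointwise algebra of the two derivatives
  set κ : ℝ := ∑ p ∈ S, dδ p * h p b with hκ
  have hδsum : ∀ p, ∑ a, h p a * (if a = b then dδ p else 0) = dδ p * h p b := fun p => by
    simp [mul_ite, Finset.sum_ite_eq', mul_comm]
  have hsumU : ∀ U, ∑ p ∈ S, ∑ a, h p a * (Real.sqrt β * (σ * (if a = b then dδ p else 0) + err U p a)) =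
      Real.sqrt β * (σ * κ + ∑ p ∈ S, ∑ a, h p a * err U p a) := fun U => by
    have hp : ∀ p, ∑ a, h p a * (Real.sqrt β * (σ * (if a = b then dδ p else 0) + err U p a)) =
        Real.sqrt β * σ * (dδ p * h p b) + Real.sqrt β * ∑ a, h p a * err U p a := fun p => by
      have : ∀ a, h p a * (Real.sqrt β * (σ * (if a = b then dδ p else 0) + err U p a)) =
          Real.sqrt β * σ * (h p a * (if a = b then dδ p else 0)) + Real.sqrt β * (h p a * err U p a) := fun a => by ring
      rw [Finset.sum_congr rfl (fun a _ => this a), Finset.sum_add_distrib, ← Finset.mul_sum, ← Finset.mul_sum, hδsum p]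
    rw [Finset.sum_congr rfl (fun p _ => hp p), Finset.sum_add_distrib, ← Finset.mul_sum, ← Finset.mul_sum, hκ]
    ring
  have hℓPe : ∀ U, ℓ U = ∑ q ∈ Pe, dδ q * Y U q b := fun U => by
    rw [hℓ]
    exact (Finset.sum_subset hPS fun p hpS hpPe => by rw [hδ0 p hpS hpPe, zero_mul]).symm
  -- integrability of the two derivatives
  have haint : Integrable (fun U => Fn' (L U) * ∑ p ∈ S, ∑ a, h p a *
      (Real.sqrt β * (σ * (if a = b then dδ p else 0) + err U p a))) μ := by
    refine Integrable.of_bound (ha' ▸ ham).aestronglyMeasurable (1 * LL) (ae_of_all _ fun U => ?_)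
    rw [Real.norm_eq_abs, abs_mul]
    exact mul_le_mul (hFb' _) (hLLb U) (abs_nonneg _) zero_le_one
  have hbint : Integrable (fun U => Fn (L U) * (β * D U)) μ := by
    refine Integrable.of_bound (hb' ▸ hbm).aestronglyMeasurable (1 * (β * LD)) (ae_of_all _ fun U => ?_)
    rw [Real.norm_eq_abs, abs_mul, abs_mul, abs_of_pos hβ]
    exact mul_le_mul (hFb _) (mul_le_mul_of_nonneg_left (hDb U) hβ.le) (mul_nonneg hβ.le (abs_nonneg _)) zero_le_one
  have hF'int : Integrable (fun U => Fn' (L U)) μ :=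
    Integrable.of_bound (hFn'c.comp hLc).measurable.aestronglyMeasurable 1
      (ae_of_all _ fun U => by rw [Real.norm_eq_abs]; exact hFb' _)
  obtain ⟨Cℓ, -, hCℓ⟩ := exists_abs_le_of_continuous hℓc
  have hFℓint : Integrable (fun U => Fn (L U) * ℓ U) μ :=
    Integrable.of_bound ((hFnc.comp hLc).mul hℓc).measurable.aestronglyMeasurable (1 * Cℓ)
      (ae_of_all _ fun U => by rw [Real.norm_eq_abs, abs_mul]; exact mul_le_mul (hFb _) (hCℓ U) (abs_nonneg _) zero_le_one)
  -- the two remainders, pointwise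
  have hrem1 : ∀ U, |(Fn' (L U) * ∑ p ∈ S, ∑ a, h p a * (Real.sqrt β * (σ * (if a = b then dδ p else 0) + err U p a))) /
      Real.sqrt β - σ * κ * Fn' (L U)| ≤ ∑ p ∈ S, ∑ a, |h p a| * (θ / 2 + K * W U p / (2 * θ)) := fun U => by
    rw [hsumU U, show Fn' (L U) * (Real.sqrt β * (σ * κ + ∑ p ∈ S, ∑ a, h p a * err U p a)) / Real.sqrt β -
      σ * κ * Fn' (L U) = Fn' (L U) * ∑ p ∈ S, ∑ a, h p a * err U p a by field_simp; ring, abs_mul]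
    refine (mul_le_of_le_one_left (abs_nonneg _) (hFb' _)).trans ?_
    refine (Finset.abs_sum_le_sum_abs _ _).trans (Finset.sum_le_sum fun p _ => ?_)
    refine (Finset.abs_sum_le_sum_abs _ _).trans (Finset.sum_le_sum fun a _ => ?_)
    rw [abs_mul]
    refine mul_le_mul_of_nonneg_left ((abs_le_amgm hθ _).trans (add_le_add le_rfl ?_)) (abs_nonneg _)
    exact div_le_div_of_nonneg_right ((herr U p a).2) (by positivity)
  have hrem2 : ∀ U, |Fn (L U) * (β * D U) / Real.sqrt β - σ * (Fn (L U) * ℓ U)| ≤ K * Real.sqrt β * ∑ q ∈ Pe, W U q :=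
    fun U => by
    have hβs : β / Real.sqrt β = Real.sqrt β := Real.div_sqrt
    rw [show Fn (L U) * (β * D U) / Real.sqrt β - σ * (Fn (L U) * ℓ U) =
      Fn (L U) * (β / Real.sqrt β * D U - σ * ℓ U) by ring, hβs, hℓPe U, abs_mul]
    exact (mul_le_of_le_one_left (abs_nonneg _) (hFb _)).trans (hDer U).2
  -- integrability of the bounds
  have hΦc : Continuous fun U => ∑ p ∈ S, ∑ a, |h p a| * (θ / 2 + K * W U p / (2 * θ)) :=
    continuous_finsetSum _ fun p _ => continuous_finsetSum _ fun a _ =>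
      continuous_const.mul (continuous_const.add ((continuous_const.mul (hWc p)).div_const _))
  obtain ⟨CΦ, -, hCΦ⟩ := exists_abs_le_of_continuous hΦc
  have hΦint : Integrable (fun U => ∑ p ∈ S, ∑ a, |h p a| * (θ / 2 + K * W U p / (2 * θ))) μ :=
    Integrable.of_bound hΦc.measurable.aestronglyMeasurable CΦ (ae_of_all _ fun U => by rw [Real.norm_eq_abs]; exact hCΦ U)
  have hSWc : Continuous fun U => K * Real.sqrt β * ∑ q ∈ Pe, W U q :=
    continuous_const.mul (continuous_finsetSum _ fun q _ => hWc q)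
  obtain ⟨CSW, -, hCSW⟩ := exists_abs_le_of_continuous hSWc
  have hSWint : Integrable (fun U => K * Real.sqrt β * ∑ q ∈ Pe, W U q) μ :=
    Integrable.of_bound hSWc.measurable.aestronglyMeasurable CSW (ae_of_all _ fun U => by rw [Real.norm_eq_abs]; exact hCSW U)
  -- the integrals of the remainders
  have hI1 : ∫ U, ((Fn' (L U) * ∑ p ∈ S, ∑ a, h p a * (Real.sqrt β * (σ * (if a = b then dδ p else 0) + err U p a))) /
      Real.sqrt β - σ * κ * Fn' (L U)) ∂μ =
      (∫ U, Fn' (L U) * ∑ p ∈ S, ∑ a, h p a * (Real.sqrt β * (σ * (if a = b then dδ p else 0) + err U p a)) ∂μ) /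
        Real.sqrt β - σ * κ * ∫ U, Fn' (L U) ∂μ := by
    rw [integral_sub (haint.div_const _) (hF'int.const_mul _), integral_div, integral_const_mul]
  have hI2 : ∫ U, (Fn (L U) * (β * D U) / Real.sqrt β - σ * (Fn (L U) * ℓ U)) ∂μ =
      (∫ U, Fn (L U) * (β * D U) ∂μ) / Real.sqrt β - σ * ∫ U, Fn (L U) * ℓ U ∂μ := by
    rw [integral_sub (hbint.div_const _) (hFℓint.const_mul _), integral_div, integral_const_mul]
  have hB1 := norm_integral_le_of_norm_le hΦint (ae_of_all _ fun U => by
    rw [Real.norm_eq_abs]; exact hrem1 U)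
  have hB2 := norm_integral_le_of_norm_le hSWint (ae_of_all _ fun U => by
    rw [Real.norm_eq_abs]; exact hrem2 U)
  rw [Real.norm_eq_abs, hI1] at hB1
  rw [Real.norm_eq_abs, hI2, integral_const_mul] at hB2
  -- conclusion
  have hkey : σ * (κ * (∫ U, Fn' (L U) ∂μ) - ∫ U, Fn (L U) * ℓ U ∂μ) =
      ((∫ U, Fn (L U) * (β * D U) ∂μ) / Real.sqrt β - σ * ∫ U, Fn (L U) * ℓ U ∂μ) -
        ((∫ U, Fn' (L U) * ∑ p ∈ S, ∑ a, h p a * (Real.sqrt β * (σ * (if a = b then dδ p else 0) + err U p a)) ∂μ) /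
          Real.sqrt β - σ * κ * ∫ U, Fn' (L U) ∂μ) := by
    rw [hdiff]; ring
  have habs : |κ * (∫ U, Fn' (L U) ∂μ) - ∫ U, Fn (L U) * ℓ U ∂μ| =
      |σ * (κ * (∫ U, Fn' (L U) ∂μ) - ∫ U, Fn (L U) * ℓ U ∂μ)| := by rw [abs_mul, hσabs, one_mul]
  rw [habs, hkey]
  exact (abs_sub _ _).trans (by linarith)

end Core

end TangentSteinFiniteBeta

/-- Registered helper stub `stub_steinCore` of line `Sketch` (crux `stmt-QuantumFields-8760`): the statement of
`TangentSteinFiniteBeta.core_defect` (see its docstring), fully qualified. -/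
theorem stub_steinCore :
    ∀ {X : Type} [TopologicalSpace X] [CompactSpace X] [MeasurableSpace X] [OpensMeasurableSpace X] (μ : MeasureTheory.Measure X) [MeasureTheory.IsProbabilityMeasure μ] {β : ℝ} (hβ : 0 < β)
    {ι : Type} (S Pe : Finset ι) (hPS : Pe ⊆ S) {Dc : ℕ} (b : Fin Dc) (h : ι → Fin Dc → ℝ)
    (dδ : ι → ℝ) (hδ0 : ∀ p ∈ S, p ∉ Pe → dδ p = 0) {Cδ : ℝ} (hCδ0 : 0 ≤ Cδ) (hCδ : ∀ p, |dδ p| ≤ Cδ)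
    (σ : ℝ) (hσ : σ = 1 ∨ σ = -1)
    (T : ℝ → X → X) (hT0 : ∀ U, T 0 U = U) (hflow : ∀ s t U, T (t + s) U = T t (T s U))
    (hTc : Continuous fun q : ℝ × X => T q.1 q.2)
    (Y : X → ι → Fin Dc → ℝ) (hYc : ∀ p a, Continuous fun U => Y U p a)
    (W : X → ι → ℝ) (hWc : ∀ p, Continuous fun U => W U p)
    (Se : X → ℝ) (hSec : Continuous Se)
    (L : X → ℝ) (hL : ∀ U, L U = ∑ p ∈ S, ∑ a, h p a * Y U p a)
    (ℓ : X → ℝ) (hℓ : ∀ U, ℓ U = ∑ p ∈ S, dδ p * Y U p b)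
    (K : ℝ) (hK : 0 ≤ K)
    (hY : ∀ (U : X) (p : ι) (a : Fin Dc), ∃ err : ℝ,
      HasDerivAt (fun t => Y (T t U) p a) (Real.sqrt β * (σ * (if a = b then dδ p else 0) + err)) 0 ∧
      err ^ 2 ≤ K * W U p)
    (hD : ∀ U : X, ∃ D : ℝ, HasDerivAt (fun t => Se (T t U)) D 0 ∧
      |Real.sqrt β * D - σ * ∑ q ∈ Pe, dδ q * Y U q b| ≤ K * Real.sqrt β * ∑ q ∈ Pe, W U q)
    (Fn Fn' : ℝ → ℝ) (hFn : ∀ x, HasDerivAt Fn (Fn' x) x) (hFn'c : Continuous Fn')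
    (hFb : ∀ x, |Fn x| ≤ 1) (hFb' : ∀ x, |Fn' x| ≤ 1) (hFlip : ∀ x y, |Fn x - Fn y| ≤ |x - y|)
    (hHaar : ∀ t : ℝ, ∫ U, Fn (L (T t U)) ∂μ = ∫ U, Fn (L U) * Real.exp (-(β * (Se (T (-t) U) - Se U))) ∂μ)
    {θ : ℝ} (hθ : 0 < θ),
      |(∑ p ∈ S, dδ p * h p b) * (∫ U, Fn' (L U) ∂μ) - ∫ U, Fn (L U) * ℓ U ∂μ| ≤
      (∫ U, ∑ p ∈ S, ∑ a, |h p a| * (θ / 2 + K * W U p / (2 * θ)) ∂μ) +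
        K * Real.sqrt β * ∫ U, ∑ q ∈ Pe, W U q ∂μ :=
  @TangentSteinFiniteBeta.core_defect

end Summit.QuantumFields.YangMills.Theorems.EquipartitionPinsProbe

end
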